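import Literature.MathematicalPhysics.QuantumLattice.FreeFermiGasPairingCost
import Literature.MathematicalPhysics.QuantumLattice.HubbardGrandCanonicalDensity
import HarnessLib

/-!
# A coupling floor for `d`-wave pair order in repulsive Hubbard ground states (torus, weak coupling)

Family `hubbard` / trunk T-QLATTICE. THEOREM (`re_expect_pairField_dWave_lt_of_groundStateInSector`):
on the fermionic torus `(ℤ/Lℤ)²`, for `c > 0`, `0 ≤ U < 4·(min(c,1)/48)⁶` and `L ≥ ⌈384/c⌉ + 3`, EVERY
normalised ground state `ψ` of the repulsive Hubbard Hamiltonian `hubbardTorus 2 L 1 U` in any sector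
`(2n, S^z = 0)`, `n ≤ L²`, has `d_{x²-y²}` pair density below `c`:
`Re ⟨ψ, Δ_d† Δ_d ψ⟩ < c · L⁴` (`Δ_d = pairField dWaveFormFactor L`). Equivalently
(`hubbardTorus_groundState_pairLRO_coupling_floor`): pair LRO of density `c` in a sector ground
state forces `4·(min(c,1)/48)⁶ ≤ U`.

Mechanism: a sector ground state at coupling `U ≥ 0` has FREE kinetic energy at most `U·L²` above
the free sector ground energy (`re_expect_hubbardTorus_zero_le_of_groundStateInSector`: variational
principle against a free sector ground state and `0 ≤ Σ_x n_{x↑}n_{x↓} ≤ L²`), while `d`-wave pair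
LRO of density `c` in ANY unit sector vector costs free kinetic energy `≥ 4(min(c,1)/48)⁶ · L²`
(`freeDWavePairing_costs_energy_rate`, `FreeFermiGasPairingCost.lean`).

This is an unconditional, if crude, counterpart of the expected weak-coupling invisibility of pairing
(`c(U) ~ e^{-O(1/U²)}`); it is the first a-priori upper bound on the ground-state `d`-wave pair density
of the 2D Hubbard model in the tree. Context: target `BirGroundStateAverageLRO` of route
`HubbardSuperconductivity/BalabanIR` (its coupling window must satisfy `4(min(c,1)/48)⁶ ≤ U₁`).

Sources: Bardeen–Cooper–Schrieffer, Phys. Rev. 108 (1957) 1175, §II; C. N. Yang, Rev. Mod. Phys. 34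
(1962) 694, §3; H. Tasaki, *Physics and Mathematics of Quantum Many-Body Systems* (2020) §2.2
(variational principle). Folklore finite-dimensional statements; no named facts, no definitions.

## Mathlib / tree search

Tree: `freeDWavePairing_costs_energy_rate`, `szSector_groundState`, `exists_smul_unit`,
`minEnergyOn_le_rayleigh_of_mem`, `hamiltonianWith_sub_hamiltonianWith`,
`posSemidef_sum_numberOp_mul_numberOp`, `posSemidef_card_sub_sum_numberOp_mul_numberOp`,
`LiebThm1.hamiltonian_isHermitian`, `IsGroundStateInSector`.
-/

noncomputable section

namespace Literature.MathematicalPhysics.QuantumLattice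

open Matrix Finset Literature.Probability.LatticeModels
open scoped ComplexOrder

section Generic

variable {Λ : Type*} [LinearOrder Λ] [Fintype Λ] (G : SimpleGraph Λ) [DecidableRel G.Adj]

/-- `H(1,U) = H(1,0) + U·Σ_x n_{x↑}n_{x↓}`. [folklore] -/
theorem hamiltonian_one_eq_zero_add_smul_interaction (U : ℝ) :
    hamiltonian G 1 U = hamiltonian G 1 0 + (U : ℂ) • ∑ x : Λ, numberOp x 0 * numberOp x 1 := by
  have h := hamiltonianWith_sub_hamiltonianWith G 1 0 U 0
  simp only [hamiltonianWith_zero, sub_zero] at h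
  rw [← h]
  abel

/-- `0 ≤ Re ⟨ψ, Σ_x n_{x↑}n_{x↓} ψ⟩ ≤ |Λ| · Re ⟨ψ, ψ⟩`. [folklore] -/
theorem re_expect_interaction_mem_Icc (ψ : Fock (Orb Λ)) :
    (star ψ ⬝ᵥ ((∑ x : Λ, numberOp x 0 * numberOp x 1 : Matrix (Finset (Orb Λ)) _ ℂ) *ᵥ ψ)).re ∈
      Set.Icc 0 ((Fintype.card Λ : ℝ) * (star ψ ⬝ᵥ ψ).re) := by
  constructor
  · have h := (posSemidef_sum_numberOp_mul_numberOp (Λ := Λ)).dotProduct_mulVec_nonneg ψ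
    exact (Complex.nonneg_iff.1 h).1
  · have h := (posSemidef_card_sub_sum_numberOp_mul_numberOp (Λ := Λ)).dotProduct_mulVec_nonneg ψ
    rw [sub_mulVec, Matrix.smul_mulVec, one_mulVec, dotProduct_sub, dotProduct_smul] at h
    have h' := (Complex.nonneg_iff.1 h).1
    rw [Complex.sub_re] at h'
    have hre : ((((Fintype.card Λ : ℕ) : ℂ)) • (star ψ ⬝ᵥ ψ)).re =
        (Fintype.card Λ : ℝ) * (star ψ ⬝ᵥ ψ).re := by
      rw [smul_eq_mul, ← Complex.ofReal_natCast, Complex.re_ofReal_mul]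
    linarith [hre]

end Generic

variable {L : ℕ} [NeZero L]

omit [NeZero L] in
/-- `H(1,U) = H(1,0) + U·Σ_x n_{x↑}n_{x↓}` on the fermionic torus. [folklore] -/
theorem hubbardTorus_eq_zero_add_smul_interaction (U : ℝ) :
    hubbardTorus 2 L 1 U = hubbardTorus 2 L 1 0 +
      (U : ℂ) • ∑ x : FermionTorus 2 L, numberOp x 0 * numberOp x 1 :=
  hamiltonian_one_eq_zero_add_smul_interaction (fermionTorusGraph 2 L) U

omit [NeZero L] in
/-- `0 ≤ Re ⟨ψ, Σ_x n_{x↑}n_{x↓} ψ⟩ ≤ L² · Re ⟨ψ, ψ⟩` on the torus of side `L`. [folklore] -/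
theorem re_expect_interaction_torus_mem_Icc (ψ : Fock (Orb (FermionTorus 2 L))) :
    (star ψ ⬝ᵥ ((∑ x : FermionTorus 2 L, numberOp x 0 * numberOp x 1 :
        Matrix (Finset (Orb (FermionTorus 2 L))) _ ℂ) *ᵥ ψ)).re ∈
      Set.Icc 0 ((L : ℝ) ^ 2 * (star ψ ⬝ᵥ ψ).re) := by
  have h := re_expect_interaction_mem_Icc ψ
  have hcard : (Fintype.card (FermionTorus 2 L) : ℝ) = (L : ℝ) ^ 2 := by
    rw [show Fintype.card (FermionTorus 2 L) = L ^ 2 by simp]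
    push_cast
    ring
  rwa [hcard] at h

omit [NeZero L] in
/-- **Free kinetic energy of an interacting sector ground state.** For `U ≥ 0` and `n ≤ L²`, a
normalised ground state `ψ` of `hubbardTorus 2 L 1 U` in the sector `(2n, S^z = 0)` has
`Re ⟨ψ, H(1,0) ψ⟩ ≤ minEnergyOn H(1,0) (szSector (2n) 0) + U·L²` (variational principle with a free
sector ground state, `0 ≤ Σ n↑n↓ ≤ L²`). Tasaki (2020) §2.2. [folklore] -/
theorem re_expect_hubbardTorus_zero_le_of_groundStateInSector {U : ℝ} (hU : 0 ≤ U) {n : ℕ}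
    (hn : n ≤ L ^ 2) {ψ : Fock (Orb (FermionTorus 2 L))}
    (hψ : IsGroundStateInSector (hubbardTorus 2 L 1 U) (2 * n) 0 ψ) (h1 : star ψ ⬝ᵥ ψ = 1) :
    (star ψ ⬝ᵥ (hubbardTorus 2 L 1 0 *ᵥ ψ)).re ≤
      (hubbardTorus 2 L 1 0).minEnergyOn (szSector (Λ := FermionTorus 2 L) (2 * n) 0) +
        U * (L : ℝ) ^ 2 := by
  -- a normalised free sector ground state `φ`
  have hn' : n ≤ Fintype.card (FermionTorus 2 L) := by simpa using hn
  obtain ⟨⟨φ₀, hφ₀S, hφ₀0, hHφ₀⟩, -⟩ := szSector_groundState (fermionTorusGraph 2 L) 1 0 hn'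
  obtain ⟨a, -, hφ1⟩ := exists_smul_unit hφ₀0
  have hφS : a • φ₀ ∈ szSector (Λ := FermionTorus 2 L) (2 * n) 0 := Submodule.smul_mem _ _ hφ₀S
  have hHφ : hubbardTorus 2 L 1 0 *ᵥ (a • φ₀) =
      (((hubbardTorus 2 L 1 0).minEnergyOn (szSector (Λ := FermionTorus 2 L) (2 * n) 0) : ℝ) : ℂ) •
        (a • φ₀) := by
    rw [mulVec_smul, smul_comm]
    exact congrArg (a • ·) hHφ₀
  -- variational principle for `H(1,U)` on `φ`
  have hHU : (hubbardTorus 2 L 1 U).IsHermitian := LiebThm1.hamiltonian_isHermitian _ 1 U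
  have hvar := minEnergyOn_le_rayleigh_of_mem hHU _ hφS hφ1
  have hφfree : (star (a • φ₀) ⬝ᵥ (hubbardTorus 2 L 1 0 *ᵥ (a • φ₀))).re =
      (hubbardTorus 2 L 1 0).minEnergyOn (szSector (Λ := FermionTorus 2 L) (2 * n) 0) := by
    rw [hHφ, dotProduct_smul, smul_eq_mul, hφ1, mul_one, Complex.ofReal_re]
  have hφD := (re_expect_interaction_torus_mem_Icc (a • φ₀)).2
  rw [hφ1, Complex.one_re, mul_one] at hφD
  have hsplitφ : (star (a • φ₀) ⬝ᵥ (hubbardTorus 2 L 1 U *ᵥ (a • φ₀))).re =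
      (star (a • φ₀) ⬝ᵥ (hubbardTorus 2 L 1 0 *ᵥ (a • φ₀))).re +
        U * (star (a • φ₀) ⬝ᵥ ((∑ x : FermionTorus 2 L, numberOp x 0 * numberOp x 1 :
          Matrix (Finset (Orb (FermionTorus 2 L))) _ ℂ) *ᵥ (a • φ₀))).re := by
    rw [hubbardTorus_eq_zero_add_smul_interaction U, add_mulVec, Matrix.smul_mulVec, dotProduct_add,
      dotProduct_smul, smul_eq_mul, Complex.add_re, Complex.re_ofReal_mul]
  -- the interacting ground state `ψ`
  obtain ⟨-, -, hHψ⟩ := hψ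
  have hψU : (star ψ ⬝ᵥ (hubbardTorus 2 L 1 U *ᵥ ψ)).re =
      (hubbardTorus 2 L 1 U).minEnergyOn (szSector (Λ := FermionTorus 2 L) (2 * n) 0) := by
    rw [hHψ, dotProduct_smul, smul_eq_mul, h1, mul_one, Complex.ofReal_re]
  have hsplitψ : (star ψ ⬝ᵥ (hubbardTorus 2 L 1 U *ᵥ ψ)).re =
      (star ψ ⬝ᵥ (hubbardTorus 2 L 1 0 *ᵥ ψ)).re +
        U * (star ψ ⬝ᵥ ((∑ x : FermionTorus 2 L, numberOp x 0 * numberOp x 1 :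
          Matrix (Finset (Orb (FermionTorus 2 L))) _ ℂ) *ᵥ ψ)).re := by
    rw [hubbardTorus_eq_zero_add_smul_interaction U, add_mulVec, Matrix.smul_mulVec, dotProduct_add,
      dotProduct_smul, smul_eq_mul, Complex.add_re, Complex.re_ofReal_mul]
  have hψD := (re_expect_interaction_torus_mem_Icc ψ).1
  have h1' : U * (star (a • φ₀) ⬝ᵥ ((∑ x : FermionTorus 2 L, numberOp x 0 * numberOp x 1 :
      Matrix (Finset (Orb (FermionTorus 2 L))) _ ℂ) *ᵥ (a • φ₀))).re ≤ U * (L : ℝ) ^ 2 :=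
    mul_le_mul_of_nonneg_left hφD hU
  have h2' : 0 ≤ U * (star ψ ⬝ᵥ ((∑ x : FermionTorus 2 L, numberOp x 0 * numberOp x 1 :
      Matrix (Finset (Orb (FermionTorus 2 L))) _ ℂ) *ᵥ ψ)).re := mul_nonneg hU hψD
  linarith

/-- **Coupling floor for `d`-wave pair LRO in a sector ground state.** If a normalised ground state
`ψ` of `hubbardTorus 2 L 1 U` (`U ≥ 0`) in a sector `(2n, S^z = 0)`, `n ≤ L²`, `L ≥ ⌈384/c⌉ + 3`, has
`Re ⟨ψ, Δ_d†Δ_d ψ⟩ ≥ c·L⁴` (`c > 0`), then `4·(min(c,1)/48)⁶ ≤ U`. [folklore] -/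
theorem hubbardTorus_groundState_pairLRO_coupling_floor {c U : ℝ} (hc : 0 < c) (hU : 0 ≤ U)
    (hL : ⌈384 / c⌉₊ + 3 ≤ L) {n : ℕ} (hn : n ≤ L ^ 2) {ψ : Fock (Orb (FermionTorus 2 L))}
    (hψ : IsGroundStateInSector (hubbardTorus 2 L 1 U) (2 * n) 0 ψ) (h1 : star ψ ⬝ᵥ ψ = 1)
    (hY : c * (L : ℝ) ^ 4 ≤
      (star ψ ⬝ᵥ (((pairField dWaveFormFactor L)ᴴ * pairField dWaveFormFactor L) *ᵥ ψ)).re) :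
    4 * (min c 1 / 48) ^ 6 ≤ U := by
  have hcost := freeDWavePairing_costs_energy_rate hc hL hψ.1 h1 hY
  have hfree := re_expect_hubbardTorus_zero_le_of_groundStateInSector hU hn hψ h1
  have hL2 : (0 : ℝ) < (L : ℝ) ^ 2 := by
    have : (0 : ℝ) < (L : ℝ) := by exact_mod_cast Nat.pos_of_ne_zero (NeZero.ne L)
    positivity
  have hmul : 4 * (min c 1 / 48) ^ 6 * (L : ℝ) ^ 2 ≤ U * (L : ℝ) ^ 2 := by linarith
  exact le_of_mul_le_mul_right hmul hL2

/-- **Weak repulsion carries little `d`-wave pair order (a-priori bound).** For `c > 0`,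
`0 ≤ U < 4·(min(c,1)/48)⁶`, `L ≥ ⌈384/c⌉ + 3` and `n ≤ L²`, EVERY normalised ground state `ψ` of
`hubbardTorus 2 L 1 U` in the sector `(2n, S^z = 0)` has `Re ⟨ψ, Δ_d†Δ_d ψ⟩ < c·L⁴`.
Bardeen–Cooper–Schrieffer (1957) §II; Yang (1962) §3. [folklore] -/
theorem re_expect_pairField_dWave_lt_of_groundStateInSector {c U : ℝ} (hc : 0 < c) (hU0 : 0 ≤ U)
    (hU : U < 4 * (min c 1 / 48) ^ 6) (hL : ⌈384 / c⌉₊ + 3 ≤ L) {n : ℕ} (hn : n ≤ L ^ 2)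
    {ψ : Fock (Orb (FermionTorus 2 L))}
    (hψ : IsGroundStateInSector (hubbardTorus 2 L 1 U) (2 * n) 0 ψ) (h1 : star ψ ⬝ᵥ ψ = 1) :
    (star ψ ⬝ᵥ (((pairField dWaveFormFactor L)ᴴ * pairField dWaveFormFactor L) *ᵥ ψ)).re <
      c * (L : ℝ) ^ 4 := by
  by_contra h
  push Not at h
  have := hubbardTorus_groundState_pairLRO_coupling_floor hc hU0 hL hn hψ h1 h
  linarith

end Literature.MathematicalPhysics.QuantumLattice
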